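import Mathlib

/-!
# T6N3Datum — the datum of N3 (Proposition N*: the reduction of (N) to the hypotheses (i) / (ii))

Cell pub-hodge-repro2, Tier 6 (README §10), seat t6-p3 (second assignment, M2: TARGET-T6.md v0.4 §9,
the lead's M2 word STATUS l. 4691 — «t6-p3 (N3 datum: π₀, π₀′, the tori T_A, T_B, the τ′-vectors, ℓ_A,
ℓ_B)», one definition-lane file, no display). Record formalised: TIER5 §N3 = route/T5-N3-route-2.md
v0.15 (STATEMENT N3.1, the standing data N3.2 (a)–(g), the proof N3.4 = N3.L0–N3.L8, the rows
T1–T8 of N3.3).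

DESIGN. The objects of N3.2 are carried as DATA over abstract Hilbert spaces — the automorphic
`L²`-spaces of the two compact quotients `[H] = U(W₁₂)(F)\U(W₁₂)(𝔸)` (one per side, `N3Side`) and
`[G] = U(V)(F)\U(V)(𝔸)` (shared, `N3Datum`), the groups of finite adelic points acting on them, the
(finite) Schwartz spaces with the Weil representations, the theta lift `Θ` and the lift `K` in the other
direction, the cuspidal subrepresentation `π₀` with the copies of its isotypic component, the
`τ′`-isotypic vectors, the toric period `P_χ`, and the product `F = η_a η_b` of the two vertex forms.
Every field is an OBJECT defined in the record (its docstring says where); no field is a theorem. The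
printed theorems about these objects (rows T1–T8) are the DISPLAYS of `T6N3Hyp.lean` and the [A]-class
identities of N3.2–N3.4 are INTERFACE Props (separate `def … : Prop`, binders of the N3 mains —
discharged in kernel where elementary, else declared residual at M2, TARGET-T6 §9.5), never fields.
The hypotheses (i), (ii) and the conclusion of Proposition N* are DEFINED here over this vocabulary
(`N3Side.hypI`, `N3Side.hypII`, `N3Datum.ellNonzero`) so that the lead's `NAut` can take
`iA := d3.A.hypI`, `iiA := d3.A.hypII`, `ellA := d3.ellNonzero d3.A` (and `iB`, `iiB`, `ellB` on side B)
literally (§9.2(b): «DEFINED over d3's vocabulary, never opaque»).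

CONVENTIONS. Mathlib's inner product `⟪x, y⟫_ℂ` is conjugate-linear in `x` and linear in `y`; the
record's `L²` pairing `⟨a, b⟩ = ∫ a \overline{b}` is `⟪b, a⟫_ℂ`. GQT's theta lift
`Θ(f, φ)(h) = ∫_{[H]} θ(φ)(g, h) \overline{f(g)} dg` (N3.2(b)) is linear in `φ` and CONJUGATE-linear
in `f`: `Θ : S →ₗ[ℂ] (LH →ₗ⋆[ℂ] LG)`; likewise `K_ψ(g) = ∫_{[G]} θ(φ)(g, h) \overline{ψ(h)} dh`.
The archimedean Schwartz data are FIXED (the forced Fock vectors `φ₁₂,∞`, N3.2(f)); `S` is the space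
of finite Schwartz data `𝒮(𝕏(𝔸_f))`, `𝕏 = V ⊗_E W₁₂`, and `Θ φ f` means `Θ(f, φ₁₂,∞ ⊗ φ)`.

§8(d): uses an L-value-free non-vanishing device: NO.
-/

namespace Summit.Ventures.HodgeRepro2.T6

open scoped InnerProductSpace

/-- ONE SIDE of Proposition N* (side A: the skew-hermitian plane `W₁₂ = W_{111} ⊕ W_{100}` with
`H = U(W₁₂)`, the torus `T₁₂ = U(W_{111}) × U(W_{100})`, the character `χ₁₂`; side B: the same for
`W₃₄`, `T₃₄`, `χ₃₄` — TIER5 §N3.1). The shared G-side (`L²([G])`, `G(𝔸_f)`) is the parameter. -/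
structure N3Side (LG : Type) [NormedAddCommGroup LG] [InnerProductSpace ℂ LG]
    (Gf : Type) [Group Gf] where
  /-- `L²([H])`, `[H] = H(F)\H(𝔸)` compact (N3.2(a)) -/
  LH : Type
  [instNormedAddCommGroupLH : NormedAddCommGroup LH]
  [instInnerProductSpaceLH : InnerProductSpace ℂ LH]
  [instCompleteSpaceLH : CompleteSpace LH]
  /-- the group `H(𝔸_f)` of finite adelic points -/
  Hf : Type
  [instGroupHf : Group Hf]
  /-- `R(g′)`, right translation by `g′ ∈ H(𝔸_f)` on `L²([H])` (unitary; N3.L3) -/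
  R : Hf → LH →ₗᵢ[ℂ] LH
  /-- `K ⊂ H(𝔸_f)`, the open compact level fixing the finite Schwartz datum (N3.1, N3.4) -/
  K : Subgroup Hf
  /-- `𝒮((V ⊗ W_a)(𝔸_f))`, the finite Schwartz data of the first line (`a = 111` on side A) -/
  Sa : Type
  [instAddCommGroupSa : AddCommGroup Sa]
  [instModuleSa : Module ℂ Sa]
  /-- `𝒮((V ⊗ W_b)(𝔸_f))`, the finite Schwartz data of the second line (`b = 100` on side A) -/
  Sb : Type
  [instAddCommGroupSb : AddCommGroup Sb]
  [instModuleSb : Module ℂ Sb]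
  /-- `𝒮(𝕏(𝔸_f))`, `𝕏 = V ⊗_E W₁₂`, the finite Schwartz data of the doubled pair (N3.2(b)) -/
  S : Type
  [instAddCommGroupS : AddCommGroup S]
  [instModuleS : Module ℂ S]
  /-- the pure tensors `φ_a ⊗ φ_b ∈ 𝒮(𝕏(𝔸_f))` (N3.2(c): `𝒮(𝕏(𝔸)) = 𝒮((V⊗W_a)(𝔸)) ⊗ 𝒮((V⊗W_b)(𝔸))`) -/
  tensor : Sa →ₗ[ℂ] Sb →ₗ[ℂ] S
  /-- the Weil representation `ω = ω_{ψ,χ_V,χ_W}` of `H(𝔸_f)` on `𝒮(𝕏(𝔸_f))` (N3.1, N3.2(b)) -/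
  ωH : Hf → S →ₗ[ℂ] S
  /-- the Weil representation of `G(𝔸_f)` on `𝒮(𝕏(𝔸_f))` -/
  ωG : Gf → S →ₗ[ℂ] S
  /-- the Weil representation of `G(𝔸_f)` on the first line's data `𝒮((V ⊗ W_a)(𝔸_f))` -/
  ωGa : Gf → Sa →ₗ[ℂ] Sa
  /-- the Weil representation of `G(𝔸_f)` on the second line's data `𝒮((V ⊗ W_b)(𝔸_f))` -/
  ωGb : Gf → Sb →ₗ[ℂ] Sb
  /-- THE THETA LIFT `Θ(f, φ)(h) := ∫_{[H]} θ(φ)(g, h) \overline{f(g)} dg` (N3.2(b); GQT's `θ(φ, f)`),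
  linear in the Schwartz datum `φ` (archimedean part fixed) and conjugate-linear in `f ∈ L²([H])` -/
  Θ : S →ₗ[ℂ] (LH →ₗ⋆[ℂ] LG)
  /-- THE LIFT IN THE OTHER DIRECTION `K_ψ(g) := ∫_{[G]} θ(φ)(g, h) \overline{ψ(h)} dh` (N3.2(b)) -/
  Klift : S →ₗ[ℂ] (LG →ₗ⋆[ℂ] LH)
  /-- `σ = Θ_V(π₀) ⊂ L²([G])`, the theta lift of `π₀`: «the closed `G(𝔸)`-subspace of `L²([G])` spanned
  by the `Θ(f, φ)`, `f ∈ π`, `φ ∈ ω`» (N3.2(b)) — a field, because the spanning set runs over ALL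
  archimedean Schwartz data, which the finite datum `S` does not carry; N3.L5(b) («`Θ(f, φ) ∈ σ` for
  `f ∈ Π(π₀)`, `φ = φ₁₂,∞ ⊗ φ_f`») is an interface Prop of the mains -/
  σ : Submodule ℂ LG
  /-- `π₀ ⊂ L²([H])`, the irreducible cuspidal automorphic subrepresentation (ONE copy; N3.1) -/
  π₀ : Submodule ℂ LH
  /-- `m₀ = m(π₀)`, the multiplicity of `π₀` in `L²([H])` (finite: N3.2(e), Borel–Wallach (2.7)) -/
  m₀ : ℕ
  /-- the copies `π₀ ⊗ m_j`, `j < m₀`, of `π₀` in its isotypic component `Π(π₀) ≅ π₀ ⊗ M(π₀)` (N3.2(e),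
  N3.4: `(m_j)` an orthonormal basis of `M(π₀)`): `H(𝔸)`-equivariant isometries `π₀ → L²([H])` with
  pairwise orthogonal images, one of them the inclusion of the given copy `π₀ ⊗ m₁ = π₀` itself
  (equivariance, orthogonality and the inclusion clause are hypotheses of the mains, not fields) -/
  copy : Fin m₀ → (π₀ →ₗᵢ[ℂ] LH)
  /-- the vectors of `L²([H])` of `K_∞^H`-type `τ′` — `τ′` = the type spanned by the forced Fock vector
  `φ₁₂,∞` (N3.2(f)); «f ∈ π₀ with archimedean component in τ′» = `f ∈ π₀ ⊓ τ'iso` -/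
  τ'iso : Submodule ℂ LH
  /-- `C([H]) ⊂ L²([H])`, the continuous functions on the compact quotient `[H]` (N3.1: the toric period
  is defined on them; N3.L6: the `K`-finite, `K_∞`-finite vectors of the discrete spectrum are continuous) -/
  Cont : Submodule ℂ LH
  /-- THE TORIC PERIOD `P_χ(k) := ∫_{[T₁₂]} χ₁₂(t) k(t) dt` (N3.1), a linear functional on `C([H])`
  («a bounded functional on each finite-dimensional `Π(π₀)^{K,τ′}`») -/
  Ptor : Cont →ₗ[ℂ] ℂ
  /-- THE PRODUCT OF THE TWO VERTEX FORMS `F_A(φ_a, φ_b) := η_a(φ_a) · η_b(φ_b) ∈ L²([G])`, with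
  `η_i(φ_i)(h) = ∫_{[U(W_i)]} χ_i(t) θ_{W_i,V}(φ_i)(t, h) dt` (N3.2(d)); bilinear in the two finite
  Schwartz data (archimedean data the forced Fock vectors) -/
  F : Sa →ₗ[ℂ] Sb →ₗ[ℂ] LG

namespace N3Side

variable {LG : Type} [NormedAddCommGroup LG] [InnerProductSpace ℂ LG] {Gf : Type} [Group Gf]
  (𝒟 : N3Side LG Gf)

/-- the normed group structure of `L²([H])` (field) -/
instance : NormedAddCommGroup 𝒟.LH := 𝒟.instNormedAddCommGroupLH
/-- the `L²` inner product of `L²([H])` (field) -/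
instance : InnerProductSpace ℂ 𝒟.LH := 𝒟.instInnerProductSpaceLH
/-- `L²([H])` is complete (field) -/
instance : CompleteSpace 𝒟.LH := 𝒟.instCompleteSpaceLH
/-- the group structure of `H(𝔸_f)` (field) -/
instance : Group 𝒟.Hf := 𝒟.instGroupHf
/-- the additive structure of the first line's Schwartz data (field) -/
instance : AddCommGroup 𝒟.Sa := 𝒟.instAddCommGroupSa
/-- the ℂ-vector space structure of the first line's Schwartz data (field) -/
instance : Module ℂ 𝒟.Sa := 𝒟.instModuleSa
/-- the additive structure of the second line's Schwartz data (field) -/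
instance : AddCommGroup 𝒟.Sb := 𝒟.instAddCommGroupSb
/-- the ℂ-vector space structure of the second line's Schwartz data (field) -/
instance : Module ℂ 𝒟.Sb := 𝒟.instModuleSb
/-- the additive structure of `𝒮(𝕏(𝔸_f))` (field) -/
instance : AddCommGroup 𝒟.S := 𝒟.instAddCommGroupS
/-- the ℂ-vector space structure of `𝒮(𝕏(𝔸_f))` (field) -/
instance : Module ℂ 𝒟.S := 𝒟.instModuleS

end N3Side

/-- THE DATUM OF N3: the shared G-side (`L²([G])`, `G(𝔸_f)` acting by right translation, the
`K_∞^G`-type `τ` of the holomorphic `(2,0)`-forms, the τ-type automorphic subrepresentations of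
N3.L8 (1)) and the two sides A (`W₁₂`) and B (`W₃₄`) of Proposition N*. -/
structure N3Datum where
  /-- `L²([G])`, `[G] = G(F)\G(𝔸)` compact (N3.2(a)) -/
  LG : Type
  [instNormedAddCommGroupLG : NormedAddCommGroup LG]
  [instInnerProductSpaceLG : InnerProductSpace ℂ LG]
  [instCompleteSpaceLG : CompleteSpace LG]
  /-- the group `G(𝔸_f)` -/
  Gf : Type
  [instGroupGf : Group Gf]
  /-- right translation by `g′ ∈ G(𝔸_f)` on `L²([G])` (unitary) -/
  ρ : Gf → LG →ₗᵢ[ℂ] LG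
  /-- the vectors of `L²([G])` of `K_∞^G`-type `τ` — the type of the `(2,0)`-forms on `[G]` (N3.1,
  N3.2(f)); `σ^τ := σ ⊓ τiso` -/
  τiso : Submodule ℂ LG
  /-- the index set of the automorphic subrepresentations `σ′ ⊂ L²([G])` whose archimedean component is
  the `(2,0)`-cohomological module (N3.L8 (1): `𝒱 = ⊕_{σ′} σ′_f`) -/
  Aut : Type
  /-- the automorphic subrepresentations `σ′ ⊂ L²([G])` of N3.L8 (1), as closed subspaces -/
  aut : Aut → Submodule ℂ LG
  /-- side A: `W₁₂ = W_{111} ⊕ W_{100}`, `T₁₂`, `χ₁₂`, `π₀` -/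
  A : N3Side LG Gf
  /-- side B: `W₃₄ = W_{101} ⊕ W_{110}`, `T₃₄`, `χ₃₄`, `π₀′` (the transport of `π₀` along `W₃₄ ≅ W₁₂`;
  Proposition N* side B) -/
  B : N3Side LG Gf

namespace N3Datum

variable (𝒟 : N3Datum)

/-- the normed group structure of `L²([G])` (field) -/
instance : NormedAddCommGroup 𝒟.LG := 𝒟.instNormedAddCommGroupLG
/-- the `L²` inner product of `L²([G])` (field) -/
instance : InnerProductSpace ℂ 𝒟.LG := 𝒟.instInnerProductSpaceLG
/-- `L²([G])` is complete (field) -/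
instance : CompleteSpace 𝒟.LG := 𝒟.instCompleteSpaceLG
/-- the group structure of `G(𝔸_f)` (field) -/
instance : Group 𝒟.Gf := 𝒟.instGroupGf

end N3Datum

namespace N3Side

variable {LG : Type} [NormedAddCommGroup LG] [InnerProductSpace ℂ LG] {Gf : Type} [Group Gf]
  (𝒟 : N3Side LG Gf)

/-- The `K`-fixed vectors of `L²([H])`: `{f | R(k) f = f for all k ∈ K}`. -/
def Kfix : Submodule ℂ 𝒟.LH where
  carrier := {f | ∀ k ∈ 𝒟.K, 𝒟.R k f = f}
  zero_mem' := fun k _ => map_zero _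
  add_mem' := fun {f g} hf hg k hk => by
    rw [map_add, hf k hk, hg k hk]
  smul_mem' := fun c {f} hf k hk => by
    rw [map_smul, hf k hk]

/-- The `K`-fixed Schwartz data `𝒮(𝕏(𝔸_f))^K`: `{φ | ω(k) φ = φ for all k ∈ K}`. -/
def SKfix : Submodule ℂ 𝒟.S where
  carrier := {φ | ∀ k ∈ 𝒟.K, 𝒟.ωH k φ = φ}
  zero_mem' := fun k _ => map_zero _
  add_mem' := fun {φ ψ} hφ hψ k hk => by
    rw [map_add, hφ k hk, hψ k hk]
  smul_mem' := fun c {φ} hφ k hk => by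
    rw [map_smul, hφ k hk]

/-- The isotypic component `Π(π₀) = ⊕_j (π₀ ⊗ m_j) ⊂ L²([H])` (N3.2(e), N3.4): the span of the copies. -/
def isotypic : Submodule ℂ 𝒟.LH :=
  ⨆ j : Fin 𝒟.m₀, LinearMap.range (𝒟.copy j).toLinearMap

/-- `Π(π₀)^{K,τ′}`: the `K`-fixed, `τ′`-isotypic part of the isotypic component (N3.1; finite-dimensional
by N3.2(e) — a hypothesis of the N3 mains, never a field). -/
def levelPart : Submodule ℂ 𝒟.LH :=
  𝒟.isotypic ⊓ 𝒟.Kfix ⊓ 𝒟.τ'iso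

/-- HYPOTHESIS (i) OF PROPOSITION N* (TIER5 N3.1): «there are `f ∈ π₀` with archimedean component in
`τ′` and `φ_f ∈ 𝒮((V⊗W₁₂)(𝔸_f))` with `Θ(f, φ₁₂,∞ ⊗ φ_f) ≠ 0`». -/
def hypI : Prop :=
  ∃ f ∈ 𝒟.π₀ ⊓ 𝒟.τ'iso, ∃ φ : 𝒟.S, 𝒟.Θ φ f ≠ 0

/-- HYPOTHESIS (ii) OF PROPOSITION N* (TIER5 N3.1): «`P_{χ₁₂}` is not identically zero on
`Π(π₀)^{K,τ′}`» — a continuous `k ∈ Π(π₀)^{K,τ′}` with `P_χ(k) ≠ 0`. -/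
def hypII : Prop :=
  ∃ k : 𝒟.Cont, (k : 𝒟.LH) ∈ 𝒟.levelPart ∧ 𝒟.Ptor k ≠ 0

/-- The functional `ℓ(φ_a, φ_b)(ψ) := ∫_{[G]} F(φ_a, φ_b) \overline{ψ}` of N3.1 (`ℓ_A(ψ) = ∫_{[G]} F_A
\overline{ψ}`), read in Mathlib's convention as `⟪ψ, F φ_a φ_b⟫_ℂ`. -/
noncomputable def ell (φa : 𝒟.Sa) (φb : 𝒟.Sb) (ψ : LG) : ℂ :=
  ⟪ψ, 𝒟.F φa φb⟫_ℂ

end N3Side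

namespace N3Datum

variable (𝒟 : N3Datum)

/-- `σ^τ = σ ⊓ τiso`: the vectors of `K_∞^G`-type `τ` of the theta lift `σ = Θ_V(π₀)` of the given
side (N3.1: «ℓ_A^σ := ℓ_A|_σ»; N3.2(f)). -/
def sigmaTau (X : N3Side 𝒟.LG 𝒟.Gf) : Submodule ℂ 𝒟.LG :=
  X.σ ⊓ 𝒟.τiso

/-- THE CONCLUSION OF PROPOSITION N* for one side (TIER5 N3.1): «there is … a PURE tensor
`φ_f′ = φ_{a,f} ⊗ φ_{b,f}`, such that the product `F_A = η_a η_b` of the vertex forms built from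
`φ₁₂,∞ ⊗ φ_f′` satisfies `ℓ_A^σ ≢ 0` on `σ^τ`: there is `ψ ∈ σ` of `K_∞^G`-type `τ` with
`∫_{[G]} F_A \overline{ψ} ≠ 0`» (the lead's `ellA` / `ellB`). Two clauses of N3.1 are NOT part of this
Prop: «σ is irreducible» (a separate lemma of the N3 mains) and «`K`-fixed» for the pure tensor — the
proof's last paragraph (N3.4: «φ_f′ is a finite sum of pure tensors … so some pure tensor already gives
`ℓ_A^σ ≢ 0`») delivers a pure-tensor SUMMAND of a `K`-fixed function, which need not itself be `K`-fixed;
what the consumer N3.L8 uses is a pure tensor at SOME level (every finite Schwartz datum is fixed by an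
open compact subgroup — «admissible data in the sense of B7(b), any level»), which is this Prop. -/
def ellNonzero (X : N3Side 𝒟.LG 𝒟.Gf) : Prop :=
  ∃ (φa : X.Sa) (φb : X.Sb), ∃ ψ ∈ 𝒟.sigmaTau X, X.ell φa φb ψ ≠ 0

/-- `𝒱 = ⊕_{σ′} σ′_f` of N3.L8 (1): the holomorphic `(2,0)`-forms of all levels read as automorphic
forms on `[G]` — the (algebraic) sum of the `τ`-type parts of the automorphic `σ′`. -/
def V20 : Submodule ℂ 𝒟.LG :=
  ⨆ i : 𝒟.Aut, 𝒟.aut i ⊓ 𝒟.τiso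

/-- `M_A` of N3.L8 (2): the span in `L²([G])` of the single products `η_a(φ_a) η_b(φ_b)` over all finite
Schwartz data (pure tensors, any level). -/
def productModule (X : N3Side 𝒟.LG 𝒟.Gf) : Submodule ℂ 𝒟.LG :=
  Submodule.span ℂ (Set.range fun p : X.Sa × X.Sb => X.F p.1 p.2)

end N3Datum

end Summit.Ventures.HodgeRepro2.T6
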